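import Summits.Parity.GeneralizedHardyLittlewood.Theorems.LeeYangFibresAbsoluteUpgradeDefs
import Literature.NumberTheory.Sieve.LinearEquationsInPrimesCrudeBounds
import HarnessLib

/-!
# Route `LeeYangFibres`, crux `AbsoluteUpgrade` (stmt-Parity-14116), line `nlc-cells-absolute-clip`:
# the marginal Walsh identity (helper file for the registered stub `stub_clipCells`)

Three self-contained bookkeeping facts used by the clipping assembly `stub_clipCells`:
* `abs_theta_singleton_mul_pow_le` — the MARGINAL WALSH IDENTITY in inequality form: for amplitudes
  `|θ_S| ≤ 2` and non-negative cell densities `a_m` (`1 ≤ m ≤ u`), the signed `i`-th marginal of the Walsh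
  model `Σ_{j ∈ [1,u]^t} (−1)^{j_i} Θ_θ(j) ∏_k a_{j_k}` equals `Σ_S θ_S ∏_k f_{S,k}` with marginal factors
  `f_{S,k} ∈ {±â, ±ã}` (`â = Σ_m a_m`, `ã = Σ_m (−1)^m a_m`), the factor `ã` occurring for `k ∈ S Δ {i}`;
  the `S = {i}` term is `−θ_{{i}} â^t`, every other term is at most `2 |ã| â^{t−1}`, whence
  `|θ_{{i}}| â^t ≤ |marginal| + 2^{t+1} |ã| â^{t−1}`.
* `clipCells_marginal` (registered sub-goal) — the rough tuples are the disjoint union of the joint cells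
  `C_j`, `j ∈ [1,u]^t`, as soon as `N^{1/u} ≥ max(2, 2L)` (every `ψ_k(n)` is then `≥ 2` with
  `Ω(ψ_k(n)) ≤ u`, because `|ψ_k(n)| ≤ 2LN < N^{1+1/u}`), so the parity marginal over the rough tuples is
  `Σ_j (−1)^{j_i} C_j`.
* `exists_forall_le_rpow_inv` — along `u ≤ A log log log N` the sieving limit `N^{1/u}` exceeds any
  fixed `B` for `N ≥ N₁(A, B)`.
-/

noncomputable section

open scoped BigOperators
open Finset Filter

namespace Summit.Parity.GeneralizedHardyLittlewood.Theorems.AbsoluteUpgrade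

open Literature.NumberTheory.Sieve
open Summit.Parity.GeneralizedHardyLittlewood.Cruxes.AbsoluteUpgrade.NlcCellsAbsoluteClip

variable {t : ℕ}

/-! ## The marginal Walsh identity -/

/-! Throughout, `f S k` stands for the `k`-th marginal factor of the `S`-term of the signed `i`-th
marginal of the Walsh model, `f_{S,k} = Σ_{m=1}^u a_m (−1)^{m [k = i]} (−1)^{(m+1) [k ∈ S]}`
(hypothesis `hf`; no definition is introduced). -/

/-- The signed `i`-th marginal of the Walsh model factorises termwise over the forms:
`Σ_{j ∈ [1,u]^t} (−1)^{j_i} Θ_θ(j) ∏_k a_{j_k} = Σ_S θ_S ∏_k f_{S,k}`. [folklore] -/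
theorem sum_sign_walshForm_prod_eq (θ : Finset (Fin t) → ℝ) (a : ℕ → ℝ) (u : ℕ) (i : Fin t)
    {f : Finset (Fin t) → Fin t → ℝ}
    (hf : ∀ S k, f S k = ∑ m ∈ Icc 1 u, a m *
      ((if k = i then (-1 : ℝ) ^ m else 1) * (if k ∈ S then (-1 : ℝ) ^ (m + 1) else 1))) :
    ∑ j ∈ Fintype.piFinset (fun _ : Fin t => Icc 1 u), (-1 : ℝ) ^ (j i) * (walshForm θ j * ∏ k, a (j k)) =
      ∑ S : Finset (Fin t), θ S * ∏ k, f S k := by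
  -- each summand `j` expands over `S`, and the `(S, j)` term is a product over the forms `k`
  have hterm : ∀ (j : Fin t → ℕ) (S : Finset (Fin t)),
      (-1 : ℝ) ^ (j i) * ((∏ k ∈ S, (-1 : ℝ) ^ (j k + 1)) * ∏ k, a (j k)) =
        ∏ k, a (j k) * ((if k = i then (-1 : ℝ) ^ (j k) else 1) *
          (if k ∈ S then (-1 : ℝ) ^ (j k + 1) else 1)) := by
    intro j S
    rw [prod_mul_distrib, prod_mul_distrib, Fintype.prod_ite_eq', Fintype.prod_ite_mem]
    ring
  calc ∑ j ∈ Fintype.piFinset (fun _ : Fin t => Icc 1 u), (-1 : ℝ) ^ (j i) * (walshForm θ j * ∏ k, a (j k))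
      = ∑ j ∈ Fintype.piFinset (fun _ : Fin t => Icc 1 u), ∑ S : Finset (Fin t),
          θ S * ∏ k, a (j k) * ((if k = i then (-1 : ℝ) ^ (j k) else 1) *
            (if k ∈ S then (-1 : ℝ) ^ (j k + 1) else 1)) := by
        refine sum_congr rfl fun j _ => ?_
        rw [walshForm, sum_mul, mul_sum]
        refine sum_congr rfl fun S _ => ?_
        rw [← hterm j S]
        ring
    _ = ∑ S : Finset (Fin t), θ S * ∑ j ∈ Fintype.piFinset (fun _ : Fin t => Icc 1 u),
          ∏ k, a (j k) * ((if k = i then (-1 : ℝ) ^ (j k) else 1) *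
            (if k ∈ S then (-1 : ℝ) ^ (j k + 1) else 1)) := by
        rw [sum_comm]
        exact sum_congr rfl fun S _ => (mul_sum _ _ _).symm
    _ = ∑ S : Finset (Fin t), θ S * ∏ k, f S k := by
        refine sum_congr rfl fun S _ => ?_
        congr 1
        simp_rw [hf]
        exact sum_prod_piFinset (Icc 1 u) (fun k m => a m * ((if k = i then (-1 : ℝ) ^ m else 1) *
          (if k ∈ S then (-1 : ℝ) ^ (m + 1) else 1)))

/-- The four values of the marginal factors: `f_{S,i} = −â` if `i ∈ S`, `f_{S,i} = ã` if `i ∉ S`,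
and for `k ≠ i`: `f_{S,k} = −ã` if `k ∈ S`, `f_{S,k} = â` if `k ∉ S`
(`â = Σ_m a_m`, `ã = Σ_m (−1)^m a_m`). [folklore] -/
theorem margFactor_eq (a : ℕ → ℝ) (u : ℕ) (i : Fin t) {f : Finset (Fin t) → Fin t → ℝ}
    (hf : ∀ S k, f S k = ∑ m ∈ Icc 1 u, a m *
      ((if k = i then (-1 : ℝ) ^ m else 1) * (if k ∈ S then (-1 : ℝ) ^ (m + 1) else 1)))
    (S : Finset (Fin t)) (k : Fin t) :
    f S k =
      if k = i then (if k ∈ S then -∑ m ∈ Icc 1 u, a m else ∑ m ∈ Icc 1 u, (-1 : ℝ) ^ m * a m)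
      else (if k ∈ S then -∑ m ∈ Icc 1 u, (-1 : ℝ) ^ m * a m else ∑ m ∈ Icc 1 u, a m) := by
  rw [hf]
  by_cases hk : k = i
  · by_cases hS : k ∈ S
    · rw [if_pos hk, if_pos hS, ← sum_neg_distrib]
      refine sum_congr rfl fun m _ => ?_
      rw [if_pos hk, if_pos hS, pow_succ]
      have : ((-1 : ℝ) ^ m) ^ 2 = 1 := by rw [← pow_mul, mul_comm, pow_mul]; simp
      linear_combination (-a m) * this
    · rw [if_pos hk, if_neg hS]
      refine sum_congr rfl fun m _ => ?_
      rw [if_pos hk, if_neg hS]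
      ring
  · by_cases hS : k ∈ S
    · rw [if_neg hk, if_pos hS, ← sum_neg_distrib]
      refine sum_congr rfl fun m _ => ?_
      rw [if_neg hk, if_pos hS, pow_succ]
      ring
    · rw [if_neg hk, if_neg hS]
      refine sum_congr rfl fun m _ => ?_
      rw [if_neg hk, if_neg hS]
      ring

/-- `|ã| ≤ â` for non-negative `a`. [folklore] -/
theorem abs_alt_sum_le_sum (a : ℕ → ℝ) (ha : ∀ m, 0 ≤ a m) (u : ℕ) :
    |∑ m ∈ Icc 1 u, (-1 : ℝ) ^ m * a m| ≤ ∑ m ∈ Icc 1 u, a m := by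
  refine (abs_sum_le_sum_abs _ _).trans (sum_le_sum fun m _ => ?_)
  rw [abs_mul, abs_neg_one_pow, one_mul, abs_of_nonneg (ha m)]

/-- Every marginal factor is at most `â` in absolute value. [folklore] -/
theorem abs_margFactor_le (a : ℕ → ℝ) (ha : ∀ m, 0 ≤ a m) (u : ℕ) (i : Fin t)
    {f : Finset (Fin t) → Fin t → ℝ}
    (hf : ∀ S k, f S k = ∑ m ∈ Icc 1 u, a m *
      ((if k = i then (-1 : ℝ) ^ m else 1) * (if k ∈ S then (-1 : ℝ) ^ (m + 1) else 1)))
    (S : Finset (Fin t)) (k : Fin t) : |f S k| ≤ ∑ m ∈ Icc 1 u, a m := by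
  have h1 := abs_alt_sum_le_sum a ha u
  have h2 : |∑ m ∈ Icc 1 u, a m| = ∑ m ∈ Icc 1 u, a m := abs_of_nonneg (sum_nonneg fun m _ => ha m)
  rw [margFactor_eq a u i hf]
  split_ifs
  · rw [abs_neg, h2]
  · exact h1
  · rw [abs_neg]; exact h1
  · rw [h2]

/-- On the symmetric difference `S Δ {i}` the marginal factor is `±ã`. [folklore] -/
theorem abs_margFactor_eq_of_xor (a : ℕ → ℝ) (u : ℕ) (i : Fin t) {f : Finset (Fin t) → Fin t → ℝ}
    (hf : ∀ S k, f S k = ∑ m ∈ Icc 1 u, a m *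
      ((if k = i then (-1 : ℝ) ^ m else 1) * (if k ∈ S then (-1 : ℝ) ^ (m + 1) else 1)))
    (S : Finset (Fin t)) (k : Fin t) (hk : (k = i ∧ k ∉ S) ∨ (k ≠ i ∧ k ∈ S)) :
    |f S k| = |∑ m ∈ Icc 1 u, (-1 : ℝ) ^ m * a m| := by
  rw [margFactor_eq a u i hf]
  rcases hk with ⟨h1, h2⟩ | ⟨h1, h2⟩
  · rw [if_pos h1, if_neg h2]
  · rw [if_neg h1, if_pos h2, abs_neg]

/-- The `S = {i}` term: `∏_k f_{{i},k} = −â^t`. [folklore] -/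
theorem prod_margFactor_singleton (a : ℕ → ℝ) (u : ℕ) (i : Fin t) {f : Finset (Fin t) → Fin t → ℝ}
    (hf : ∀ S k, f S k = ∑ m ∈ Icc 1 u, a m *
      ((if k = i then (-1 : ℝ) ^ m else 1) * (if k ∈ S then (-1 : ℝ) ^ (m + 1) else 1))) :
    ∏ k, f {i} k = -(∑ m ∈ Icc 1 u, a m) ^ t := by
  have h : ∀ k, f {i} k = (if k = i then (-1 : ℝ) else 1) * ∑ m ∈ Icc 1 u, a m := by
    intro k
    rw [margFactor_eq a u i hf]
    by_cases hk : k = i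
    · rw [if_pos hk, if_pos (mem_singleton.mpr hk), if_pos hk]; ring
    · rw [if_neg hk, if_neg (fun h => hk (mem_singleton.mp h)), if_neg hk]; ring
  simp_rw [h]
  rw [prod_mul_distrib, Fintype.prod_ite_eq', prod_const, card_univ, Fintype.card_fin]
  ring

/-- Every `S ≠ {i}` term is small: `|∏_k f_{S,k}| ≤ |ã| â^{t-1}`. [folklore] -/
theorem abs_prod_margFactor_le (a : ℕ → ℝ) (ha : ∀ m, 0 ≤ a m) (u : ℕ) (i : Fin t)
    {f : Finset (Fin t) → Fin t → ℝ}
    (hf : ∀ S k, f S k = ∑ m ∈ Icc 1 u, a m *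
      ((if k = i then (-1 : ℝ) ^ m else 1) * (if k ∈ S then (-1 : ℝ) ^ (m + 1) else 1)))
    {S : Finset (Fin t)} (hS : S ≠ {i}) :
    |∏ k, f S k| ≤
      |∑ m ∈ Icc 1 u, (-1 : ℝ) ^ m * a m| * (∑ m ∈ Icc 1 u, a m) ^ (t - 1) := by
  -- a coordinate `k₀ ∈ S Δ {i}`
  obtain ⟨k₀, hk₀⟩ : ∃ k₀ : Fin t, (k₀ = i ∧ k₀ ∉ S) ∨ (k₀ ≠ i ∧ k₀ ∈ S) := by
    by_cases hi : i ∈ S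
    · by_contra hno
      push Not at hno
      apply hS
      refine eq_singleton_iff_unique_mem.mpr ⟨hi, fun k hk => ?_⟩
      by_contra hki
      exact (hno k).2 hki hk
    · exact ⟨i, Or.inl ⟨rfl, hi⟩⟩
  rw [Finset.abs_prod, ← mul_prod_erase univ _ (mem_univ k₀), abs_margFactor_eq_of_xor a u i hf S k₀ hk₀]
  refine mul_le_mul_of_nonneg_left ?_ (abs_nonneg _)
  calc ∏ k ∈ univ.erase k₀, |f S k| ≤ ∏ _k ∈ univ.erase k₀, ∑ m ∈ Icc 1 u, a m :=
        prod_le_prod (fun k _ => abs_nonneg _) fun k _ => abs_margFactor_le a ha u i hf S k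
    _ = (∑ m ∈ Icc 1 u, a m) ^ (t - 1) := by
        rw [prod_const, card_erase_of_mem (mem_univ k₀), card_univ, Fintype.card_fin]

/-- **The marginal Walsh identity, inequality form.** For amplitudes `|θ_S| ≤ 2` and non-negative
densities `a_m`: `|θ_{{i}}| â^t ≤ |Σ_{j ∈ [1,u]^t} (−1)^{j_i} Θ_θ(j) ∏_k a_{j_k}| + 2^{t+1} |ã| â^{t−1}`
(`â = Σ_{m ≤ u} a_m`, `ã = Σ_{m ≤ u} (−1)^m a_m`): the `S = {i}` term of the factorised marginal is
`−θ_{{i}} â^t`, and each of the other `< 2^t` terms is at most `2 |ã| â^{t−1}`. [folklore] -/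
theorem abs_theta_singleton_mul_pow_le (θ : Finset (Fin t) → ℝ) (hθ : ∀ S, |θ S| ≤ 2)
    (a : ℕ → ℝ) (ha : ∀ m, 0 ≤ a m) (u : ℕ) (i : Fin t) :
    |θ {i}| * (∑ m ∈ Icc 1 u, a m) ^ t ≤
      |∑ j ∈ Fintype.piFinset (fun _ : Fin t => Icc 1 u),
          (-1 : ℝ) ^ (j i) * (walshForm θ j * ∏ k, a (j k))| +
        2 ^ (t + 1) * |∑ m ∈ Icc 1 u, (-1 : ℝ) ^ m * a m| * (∑ m ∈ Icc 1 u, a m) ^ (t - 1) := by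
  -- the marginal factors
  set f : Finset (Fin t) → Fin t → ℝ := fun S k => ∑ m ∈ Icc 1 u, a m *
    ((if k = i then (-1 : ℝ) ^ m else 1) * (if k ∈ S then (-1 : ℝ) ^ (m + 1) else 1)) with hfdef
  have hf : ∀ S k, f S k = ∑ m ∈ Icc 1 u, a m *
      ((if k = i then (-1 : ℝ) ^ m else 1) * (if k ∈ S then (-1 : ℝ) ^ (m + 1) else 1)) :=
    fun _ _ => rfl
  set A := ∑ m ∈ Icc 1 u, a m with hA
  set B := |∑ m ∈ Icc 1 u, (-1 : ℝ) ^ m * a m| with hB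
  have hA0 : 0 ≤ A := sum_nonneg fun m _ => ha m
  have hB0 : 0 ≤ B := abs_nonneg _
  rw [sum_sign_walshForm_prod_eq θ a u i hf, ← add_sum_erase univ _ (mem_univ ({i} : Finset (Fin t))),
    prod_margFactor_singleton a u i hf]
  -- the remaining terms
  have hrest : |∑ S ∈ univ.erase {i}, θ S * ∏ k, f S k| ≤ 2 ^ (t + 1) * B * A ^ (t - 1) := by
    calc |∑ S ∈ univ.erase {i}, θ S * ∏ k, f S k|
        ≤ ∑ S ∈ univ.erase {i}, |θ S * ∏ k, f S k| := abs_sum_le_sum_abs _ _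
      _ ≤ ∑ _S ∈ univ.erase {i}, 2 * (B * A ^ (t - 1)) := by
          refine sum_le_sum fun S hS => ?_
          rw [abs_mul]
          exact mul_le_mul (hθ S) (abs_prod_margFactor_le a ha u i hf (ne_of_mem_erase hS))
            (abs_nonneg _) (by norm_num)
      _ ≤ ∑ _S : Finset (Fin t), 2 * (B * A ^ (t - 1)) :=
          sum_le_sum_of_subset_of_nonneg (erase_subset _ _) fun _ _ _ => by positivity
      _ = 2 ^ (t + 1) * B * A ^ (t - 1) := by
          rw [sum_const, card_univ, Fintype.card_finset, Fintype.card_fin, nsmul_eq_mul, pow_succ]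
          push_cast
          ring
  have key : θ {i} * A ^ t = -(θ {i} * -A ^ t + ∑ S ∈ univ.erase {i}, θ S * ∏ k, f S k) +
      ∑ S ∈ univ.erase {i}, θ S * ∏ k, f S k := by ring
  calc |θ {i}| * A ^ t = |θ {i} * A ^ t| := by rw [abs_mul, abs_of_nonneg (pow_nonneg hA0 t)]
    _ ≤ |θ {i} * -A ^ t + ∑ S ∈ univ.erase {i}, θ S * ∏ k, f S k| +
          |∑ S ∈ univ.erase {i}, θ S * ∏ k, f S k| := by
        rw [key]
        exact (abs_add_le _ _).trans (by rw [abs_neg])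
    _ ≤ _ := by gcongr

/-! ## The rough tuples decompose into the joint cells `j ∈ [1,u]^t` -/

-- adapted from Literature/NumberTheory/LFunctions/FordIncompleteS3Comb.lean (`pow_cardFactors_le`)
/-- If every prime factor of `n ≠ 0` is at least `y ≥ 0` then `y^{Ω(n)} ≤ n`. [folklore] -/
private theorem pow_cardFactors_le {n : ℕ} (hn : n ≠ 0) {y : ℝ} (hy : 0 ≤ y)
    (h : ∀ p ∈ n.primeFactors, y ≤ p) : y ^ (ArithmeticFunction.cardFactors n) ≤ n := by
  rw [ArithmeticFunction.cardFactors_apply, ← Nat.prod_primeFactorsList hn, Nat.cast_list_prod]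
  have key : ∀ l : List ℕ, (∀ p ∈ l, y ≤ p) →
      y ^ l.length ≤ (l.map (fun p : ℕ => (p : ℝ))).prod := by
    intro l hl
    induction l with
    | nil => simp
    | cons a l ih =>
      rw [List.length_cons, pow_succ, List.map_cons, List.prod_cons, mul_comm]
      have ha := hl a (by simp)
      have hl' := ih fun p hp => hl p (by simp [hp])
      exact mul_le_mul ha hl' (pow_nonneg hy _) (hy.trans ha)
  have := key n.primeFactorsList fun p hp => h p (by
    rw [Nat.mem_primeFactors_iff_mem_primeFactorsList]; exact hp)
  convert this using 2
  rw [Nat.prod_primeFactorsList hn]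

/-- The joint cell `C_j` is the fibre of the rough tuples over the cell index `j`. [folklore] -/
theorem jointCell_eq_card_filter (Ψ : Fin t → AffLinForm 1) (K : Set (Fin 1 → ℝ)) (N u : ℕ)
    (j : Fin t → ℕ) :
    jointCell Ψ K N u j = #((roughTuples Ψ K N u).filter
      (fun n => (fun k => ArithmeticFunction.cardFactors ((Ψ k).eval n).toNat) = j)) := by
  classical
  unfold jointCell roughTuples
  rw [filter_filter]
  congr 1
  refine filter_congr fun n _ => ?_
  rw [funext_iff]
  constructor
  · rintro ⟨hK, h⟩
    exact ⟨⟨hK, fun k => (h k).1⟩, fun k => (h k).2⟩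
  · rintro ⟨⟨hK, h⟩, h'⟩
    exact ⟨hK, fun k => ⟨h k, h' k⟩⟩

/-- Once `N^{1/u} ≥ max(2, 2L)`, every rough tuple has cell index in `[1,u]^t`: each `ψ_k(n)` is
`≥ 2` (so `Ω ≥ 1`), and `Ω(ψ_k(n)) ≥ u + 1` would force `ψ_k(n) > N^{(u+1)/u} = N · N^{1/u} ≥ 2LN`,
against `|ψ_k(n)| ≤ 2LN`. [folklore] -/
theorem cellIndex_mem_piFinset (Ψ : Fin t → AffLinForm 1) (K : Set (Fin 1 → ℝ)) {N u L : ℕ}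
    (hN : 1 ≤ N) (hu : 1 ≤ u) (hL : affLinSize Ψ N ≤ L) (hz2 : (2 : ℝ) ≤ (N : ℝ) ^ ((1 : ℝ) / u))
    (hzL : (2 * L : ℝ) ≤ (N : ℝ) ^ ((1 : ℝ) / u)) {n : Fin 1 → ℤ} (hn : n ∈ roughTuples Ψ K N u) :
    (fun k => ArithmeticFunction.cardFactors ((Ψ k).eval n).toNat) ∈
      Fintype.piFinset (fun _ : Fin t => Icc 1 u) := by
  classical
  rw [roughTuples, mem_filter] at hn
  obtain ⟨hbox, -, hrough⟩ := hn
  rw [Fintype.mem_piFinset]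
  intro k
  rw [mem_Icc]
  set z : ℝ := (N : ℝ) ^ ((1 : ℝ) / u) with hz
  set x : ℕ := ((Ψ k).eval n).toNat with hx
  have hzk : z < (Nat.minFac x : ℝ) := hrough k
  have hx0 : x ≠ 0 := fun h0 => by rw [h0, Nat.minFac_zero] at hzk; norm_num at hzk; linarith
  have hx1 : x ≠ 1 := fun h1 => by rw [h1, Nat.minFac_one] at hzk; norm_num at hzk; linarith
  refine ⟨ArithmeticFunction.cardFactors_pos_iff_one_lt.mpr (by omega), ?_⟩
  by_contra hΩ
  push Not at hΩ
  have hN0 : (0 : ℝ) < N := by exact_mod_cast hN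
  have hu0 : (u : ℝ) ≠ 0 := by exact_mod_cast (show u ≠ 0 by omega)
  have hz0 : 0 ≤ z := Real.rpow_nonneg hN0.le _
  -- `minFac(x)^{Ω(x)} ≤ x`
  have h1 : (Nat.minFac x : ℝ) ^ (ArithmeticFunction.cardFactors x) ≤ x :=
    pow_cardFactors_le hx0 (Nat.cast_nonneg _) fun p hp => Nat.cast_le.mpr
      (Nat.minFac_le_of_dvd (Nat.prime_of_mem_primeFactors hp).two_le (Nat.dvd_of_mem_primeFactors hp))
  have h2 : z ^ (u + 1) < (x : ℝ) :=
    calc z ^ (u + 1) ≤ z ^ (ArithmeticFunction.cardFactors x) := pow_le_pow_right₀ (by linarith) hΩ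
      _ < (Nat.minFac x : ℝ) ^ (ArithmeticFunction.cardFactors x) :=
          pow_lt_pow_left₀ hzk hz0 (by omega)
      _ ≤ x := h1
  -- `z^u = N`
  have hzu : z ^ u = N := by
    rw [hz, ← Real.rpow_natCast, ← Real.rpow_mul hN0.le, show (1 : ℝ) / u * (u : ℕ) = 1 by
      field_simp, Real.rpow_one]
  -- `x ≤ |ψ_k(n)| ≤ 2LN`
  have h3 : (x : ℝ) ≤ 2 * L * N := by
    have habs := abs_eval_le_of_affLinSize_le hN hL hbox k
    have hxle : ((x : ℕ) : ℤ) ≤ |(Ψ k).eval n| := by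
      rw [hx, Int.toNat_eq_max]
      exact max_le (le_abs_self _) (abs_nonneg _)
    have hxle' : (x : ℝ) ≤ |((Ψ k).eval n : ℝ)| := by
      have := (Int.cast_le (R := ℝ)).mpr hxle
      rwa [Int.cast_natCast, Int.cast_abs] at this
    exact hxle'.trans habs
  have h4 : (2 * L : ℝ) * N ≤ z * N := mul_le_mul_of_nonneg_right hzL hN0.le
  have h5 : z ^ (u + 1) = N * z := by rw [pow_succ, hzu]
  nlinarith

/-- **The rough tuples are the disjoint union of the joint cells `C_j`, `j ∈ [1,u]^t`**, once
`N^{1/u} ≥ max(2, 2L)`: the parity marginal of the `i`-th form over the rough tuples is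
`Σ_{j ∈ [1,u]^t} (−1)^{j_i} C_j`. [folklore] -/
theorem sum_roughTuples_sign_eq_sum_cells (Ψ : Fin t → AffLinForm 1) (K : Set (Fin 1 → ℝ))
    {N u L : ℕ} (hN : 1 ≤ N) (hu : 1 ≤ u) (hL : affLinSize Ψ N ≤ L)
    (hz2 : (2 : ℝ) ≤ (N : ℝ) ^ ((1 : ℝ) / u)) (hzL : (2 * L : ℝ) ≤ (N : ℝ) ^ ((1 : ℝ) / u)) (i : Fin t) :
    ∑ n ∈ roughTuples Ψ K N u, (-1 : ℝ) ^ (ArithmeticFunction.cardFactors ((Ψ i).eval n).toNat) =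
      ∑ j ∈ Fintype.piFinset (fun _ : Fin t => Icc 1 u), (-1 : ℝ) ^ (j i) * (jointCell Ψ K N u j : ℝ) := by
  have hmaps : ∀ n ∈ roughTuples Ψ K N u,
      (fun k => ArithmeticFunction.cardFactors ((Ψ k).eval n).toNat) ∈
        Fintype.piFinset (fun _ : Fin t => Icc 1 u) :=
    fun n hn => cellIndex_mem_piFinset Ψ K hN hu hL hz2 hzL hn
  rw [← sum_fiberwise_of_maps_to' hmaps (fun j : Fin t → ℕ => (-1 : ℝ) ^ (j i))]
  refine sum_congr rfl fun j _ => ?_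
  rw [sum_const, nsmul_eq_mul, jointCell_eq_card_filter, mul_comm]

/-- **Registered sub-goal `clipCells_marginal`** (helper for `stub_clipCells`): the rough tuples are the
disjoint union of the joint cells `C_j`, `j ∈ [1,u]^t`, once `N^{1/u} ≥ max(2, 2L)`
(`sum_roughTuples_sign_eq_sum_cells`, stated verbatim as registered). [folklore] -/
theorem clipCells_marginal : ∀ {t : ℕ} (Ψ : Fin t → AffLinForm 1) (K : Set (Fin 1 → ℝ)) {N u L : ℕ}, 1 ≤ N → 1 ≤ u → affLinSize Ψ N ≤ L → (2 : ℝ) ≤ (N : ℝ) ^ ((1 : ℝ) / u) → (2 * L : ℝ) ≤ (N : ℝ) ^ ((1 : ℝ) / u) → ∀ i : Fin t, ∑ n ∈ roughTuples Ψ K N u, (-1 : ℝ) ^ (ArithmeticFunction.cardFactors ((Ψ i).eval n).toNat) = ∑ j ∈ Fintype.piFinset (fun _ : Fin t => Finset.Icc 1 u), (-1 : ℝ) ^ (j i) * (jointCell Ψ K N u j : ℝ) :=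
  fun Ψ K _ _ _ hN hu hL hz2 hzL i => sum_roughTuples_sign_eq_sum_cells Ψ K hN hu hL hz2 hzL i

/-! ## The sieving limit `N^{1/u}` is eventually large along `u ≤ A log log log N` -/

/-- Along the slow range the sieving limit exceeds any fixed bound: for `N ≥ N₁(A, B)` and
`1 ≤ u ≤ A log log log N`, `B ≤ N^{1/u}` (`u log B ≤ A log B · log₃ N ≤ log N` since
`log y = o(y)`). [folklore] -/
theorem exists_forall_le_rpow_inv (A B : ℝ) :
    ∃ N₁ : ℕ, ∀ N : ℕ, N₁ ≤ N → ∀ u : ℕ, 1 ≤ u → (u : ℝ) ≤ A * Real.log (Real.log (Real.log N)) →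
      B ≤ (N : ℝ) ^ ((1 : ℝ) / u) := by
  set K : ℝ := max (Real.log B) 0 * max A 0 with hK
  have hK0 : 0 ≤ K := by positivity
  -- `K log y ≤ y` for large real `y`
  have hKlog : ∀ᶠ y : ℝ in atTop, K * Real.log y ≤ y := by
    have h := Real.isLittleO_log_id_atTop.def (show (0 : ℝ) < 1 / (K + 1) by positivity)
    filter_upwards [h, eventually_ge_atTop (1 : ℝ)] with y hy hy1
    rw [id, Real.norm_eq_abs, Real.norm_eq_abs, abs_of_nonneg (Real.log_nonneg hy1),
      abs_of_nonneg (by linarith : (0 : ℝ) ≤ y)] at hy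
    have h' : (K + 1) * Real.log y ≤ y := by
      have := mul_le_mul_of_nonneg_left hy (show (0 : ℝ) ≤ K + 1 by positivity)
      rwa [← mul_assoc, mul_one_div_cancel (by positivity : (K : ℝ) + 1 ≠ 0), one_mul] at this
    nlinarith [Real.log_nonneg hy1]
  have hlogN : Tendsto (fun N : ℕ => Real.log (N : ℝ)) atTop atTop :=
    Real.tendsto_log_atTop.comp tendsto_natCast_atTop_atTop
  have h1 : ∀ᶠ N : ℕ in atTop, K * Real.log (Real.log (N : ℝ)) ≤ Real.log (N : ℝ) :=
    hlogN.eventually hKlog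
  have h2 : ∀ᶠ N : ℕ in atTop, 1 ≤ Real.log (Real.log (N : ℝ)) :=
    (Real.tendsto_log_atTop.comp hlogN).eventually_ge_atTop 1
  obtain ⟨N₁, hN₁⟩ := eventually_atTop.mp (h1.and (h2.and (eventually_ge_atTop 1)))
  refine ⟨N₁, fun N hN u hu huA => ?_⟩
  obtain ⟨hK1, hll1, hN1⟩ := hN₁ N hN
  have hN0 : (0 : ℝ) < N := by exact_mod_cast hN1
  have hu0 : (0 : ℝ) < u := by exact_mod_cast hu
  have hL3 : 0 ≤ Real.log (Real.log (Real.log (N : ℝ))) := Real.log_nonneg hll1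
  have hL3le : Real.log (Real.log (Real.log (N : ℝ))) ≤ Real.log (Real.log (N : ℝ)) :=
    Real.log_le_self (by linarith)
  by_cases hB : B ≤ 1
  · exact hB.trans (Real.one_le_rpow (by exact_mod_cast hN1) (by positivity))
  push Not at hB
  have hB0 : 0 < B := by linarith
  have hlogB : 0 < Real.log B := Real.log_pos hB
  rw [Real.le_rpow_iff_log_le hB0 hN0, div_mul_eq_mul_div, one_mul, le_div_iff₀ hu0]
  calc Real.log B * u ≤ Real.log B * (A * Real.log (Real.log (Real.log N))) := by gcongr
    _ ≤ Real.log B * (max A 0 * Real.log (Real.log (Real.log N))) :=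
        mul_le_mul_of_nonneg_left (mul_le_mul_of_nonneg_right (le_max_left _ _) hL3) hlogB.le
    _ ≤ Real.log B * (max A 0 * Real.log (Real.log N)) := by gcongr
    _ = K * Real.log (Real.log N) := by rw [hK, max_eq_left hlogB.le]; ring
    _ ≤ Real.log N := hK1

end Summit.Parity.GeneralizedHardyLittlewood.Theorems.AbsoluteUpgrade

end
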